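/-
Copyright (c) 2026 the pub-hodgecm-mathlib formalisation cell (harness21).  Prover seat hodgecm-mathlib-K2E4-p13 (g0),
Track B «K2-LIT» ∕ h413, ENGINE E4 unit U6 `ArchLimitConstant` — brick (end-read)⁺ (POSITIVE constant) of the G′ package of socket #9 `sig_K2E4ExplicitArchSingularTransfer`
(the SIGNED end state: (end)± = (end-read)⁺ [THIS FILE] ∘ (end-alg)± [★ `K2E4ArchGPrimeLamPhase`], K2E4-plan 23:17:31Z).  2026-09-03.
-/
import Summits.HodgeConjecture.HodgeConjecture.Theorems.K2E4ArchGPrimeDefs                         -- ★ p855236 (K2E4-p11): `wallMeasure`, `singularWallMeasure`, `wallPoint`, `embCircle`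
import Summits.HodgeConjecture.HodgeConjecture.Theorems.F0P3ArchUniversalPinRatioOfWallCompatible   -- ★ (U) `archSingularUniversalPinRatio_of_wallCompatible`
import Summits.HodgeConjecture.HodgeConjecture.Theorems.F0P3ArchTopFormWallCompatibleHolds          -- ★ U4 discharged: `archTopFormWallCompatible_holds`
import Literature.NumberTheory.Rogawski1990.ArchStableOrbitalWallEndStateReading                    -- ★ (P1) `integral_pi_wallFactor_eq_prod_smul_classOrbitalIntegral` (the per-`ρ` reading)
import Literature.NumberTheory.Rogawski1990.ArchSingularCentralizerPinsExist                        -- ★ `exists_pinned_centralizer_families` (pinned centraliser measures, mass 1 at compact walls)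
import Literature.NumberTheory.Rogawski1990.ArchSingularCentralizerProductMeasures                  -- ★ (W2) `exists_pi_centralizer_measures` (the telescope `ρP, ρ′`)
import Literature.NumberTheory.Weil1964.UnitaryArchSingularTopFormFamilyQuotient                    -- ★ `exists_atPoint_archSingularTopFormFamily_eq` (the top-form family read at a framed point)
import Literature.NumberTheory.Weil1964.UnitaryArchSingularCentralizerWallFrames                    -- ★ `exists_isSingularArchFrame_archDiagTorus_wall'` (the wall torus points are framed)
import Literature.NumberTheory.Automorphic.ArchEndoscopicChartOrbFree                               -- ★ `quotientMeasure_eq_inv_smul_of_eq_smul` (`ν∕(κ•ρ) = κ⁻¹ • ν∕ρ`)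
import Literature.MeasureTheory.Group.InvariantQuotientScaling                                      -- ★ `quotientMeasure_smul_measure` (`(c•ν)∕ρ = c • ν∕ρ`)
import Literature.NumberTheory.Rogawski1990.LocalTransferRescale                                    -- ★ `classOrbitalIntegral_smul_measure_eq_mul`, `OrbitalMeasureFamily.smul_apply`
import Literature.NumberTheory.Automorphic.ArchTorusOrbitalFubini                                   -- ★ `isHaarMeasure_map_archPiEquivCM_symm_pi`
import HarnessLib

/-!
# K2 · E4 · U6, the G′ package of socket #9, brick (end-read)⁺: `∫ Θ ↑↑(e⁻¹ o) d(⊗_v Wm_v(ρ_v)) = r · Φ(⟦t(z⁰∘ρ)⟧, Θ∘coe; top-form family)` with ONE REAL `r > 0` for all `ρ`, `Θ`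
# (Rogawski 1990 §8.2 pp. 122–124 «a non-zero constant times `Φ^st(γ₀, f)`», §1.7 p. 6; Deitmar–Echterhoff Thm. 1.5.3)

Cell `pub/hodgecm-mathlib` (D-0151), HCML Track B, crux H413 = `stmt-HodgeConjecture-24833`; prover seat `hodgecm-mathlib-K2E4-p13` (g0) for the assembler K2E4-p09 and the `G′`-package
owner K2E4-p11 (`--supports … --as helper`).  Socket #9 `sig_K2E4ExplicitArchSingularTransfer` of `Cruxes/H413/Lines/K2_E4_SingularTransferKappaSignSigsArchLimitConstant.lean`; the
G′ package's field `end_eq` is (end) = (end-read) [THIS FILE] ∘ (end-alg) [★ `K2E4ArchGPrimeEndAlg.exists_gState_univ_eq_of_wallIntegral`].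

THE MATHEMATICS.  At `S = univ` the state measure of the relabelling family `ρ` is the product over the complex places of the WALL MEASURES `Wm_v(ρ_v)` of ★ `K2E4ArchGPrimeDefs`
(`ν_v.map conj_{diag(z⁰_v∘ρ_v)}` at a compact wall, the transported singular Weil-quotient orbit measure pinned by the reference measure `νH_v` at a noncompact one).  ★ (P1)
`integral_pi_wallFactor_eq_prod_smul_classOrbitalIntegral` reads `∫ Θ ↑↑(e⁻¹ o) d(⊗_v Wm_v(ρ_v))` as `(∏_v λ_v(ρ_v)) • Φ(⟦t(z⁰∘ρ)⟧, Θ∘coe; m)` for centraliser measures `ρZ_v(σ)`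
(★ `exists_pinned_centralizer_families`: the transported references at the noncompact walls, PROBABILITY measures at the compact ones — so every `λ_v = 1`), their telescope
`ρP, ρ′` at `t(z⁰∘ρ)` (★ (W2) `exists_pi_centralizer_measures`) and any family `m` whose member at `t(z⁰∘ρ)` is the Weil quotient `(e⁻¹_*⊗ν_v) ∕ ρ′`.  The top-form family
`archSingularTopFormFamily ν` at the framed point `t(z⁰∘ρ)` (★ `exists_isSingularArchFrame_archDiagTorus_wall'`) is `ν ∕ centralizerTopFormHaar(t(z⁰∘ρ))`
(★ `exists_atPoint_archSingularTopFormFamily_eq`), and the UNIVERSAL PIN RATIO ★ (U) `archSingularUniversalPinRatio_of_wallCompatible` (U4 ★ `archTopFormWallCompatible_holds`)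
says `centralizerTopFormHaar(t(z⁰∘ρ)) = K • ρ′` with ONE `K ≠ 0` for all `ρ`; with `ν = χ • e⁻¹_*⊗ν_v` (★ `quotientMeasure_eq_inv_smul_of_eq_smul`, ★ `quotientMeasure_smul_measure`)
the family `m := (χ⁻¹K) • archSingularTopFormFamily ν` is in (P1)'s Weil form at EVERY `t(z⁰∘ρ)`, whence the reading with `r = (χ⁻¹K).toReal` (★ `classOrbitalIntegral_smul_measure_eq_mul`).

* **`exists_pos_wallIntegral_eq_mul_classOrbitalIntegral`** — ★ (end-read) `K2E4ArchGPrimeEndRead.exists_wallIntegral_eq_mul_classOrbitalIntegral` (p855485) with the constant exported as a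
  POSITIVE REAL (`∃ r : ℝ, 0 < r ∧ … = (r : ℂ) * …`; the same witness `r = (χ⁻¹·K).toReal`, `K` the (U) ratio): the input of the SIGNED end state (K2E4-plan 23:17:31Z (c):
  ★ `K2E4ArchGPrimeLamPhase` ∕ K2E4-p14's `K2E4ArchGPrimeEndSigned`, the `lam_phase` field of ★ p855382 `GPrimeDataSigned`).  Same proof as ★ p855485, token for token, with the real witness.
HONEST LABEL: HC_CM is proved only modulo the 7 printed citations (2 remaining named inputs: hLiu418 = stmt-HodgeConjecture-24832, h413 = stmt-HodgeConjecture-24833) until rung 0 closes; this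
file is measure bookkeeping over ★ bricks and pays no socket by itself.

## References
* [Rogawski1990] J. D. Rogawski, *Automorphic Representations of Unitary Groups in Three Variables*, Ann. of Math. Stud. 123 (1990), §8.2 pp. 122–124, §14.5 p. 238, §1.7 p. 6,
  §4.3 (4.3.1) p. 43.
* [DeitmarEchterhoff2014] A. Deitmar, S. Echterhoff, *Principles of Harmonic Analysis*, 2nd ed. (2014), Thm. 1.5.3.
* [Folland1995] G. B. Folland, *A Course in Abstract Harmonic Analysis* (1995), §2.6 (2.52).
-/

set_option autoImplicit false
set_option linter.dupNamespace false  -- the cell's namespace convention `Summit.HodgeConjecture.HodgeConjecture.Cruxes.H413.<File>` repeats the summit = problem name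

noncomputable section

open MeasureTheory Measure Filter Topology NumberField NumberField.InfinitePlace NumberField.mixedEmbedding Equiv Function Set
open Literature.MeasureTheory.Group Literature.NumberTheory.Automorphic Literature.NumberTheory.Automorphic.UnitaryGroup
open Literature.LinearAlgebra.Matrix Literature.NumberTheory.Rogawski1990
open Literature.NumberTheory.Weil1964 Literature.NumberTheory.Weil1964.UnitaryArchTopForm
open Summit.HodgeConjecture.HodgeConjecture.Cruxes.H413.K2E4ArchGPrimeDefs
open Summit.HodgeConjecture.HodgeConjecture.Cruxes.H413.F0P3ArchUniversalPinRatioOfWallCompatible Summit.HodgeConjecture.HodgeConjecture.Cruxes.H413.F0P3ArchTopFormWallCompatibleHolds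
open scoped Matrix MatrixGroups Matrix.Norms.Operator ContDiff ENNReal NNReal Classical

namespace Summit.HodgeConjecture.HodgeConjecture.Cruxes.H413.K2E4ArchGPrimeEndReadPos

variable (L : Type) [Field L] [NumberField L] [IsCMField L] (α : Fin 3 → L) [iGL : MeasurableSpace (GL (Fin 3) ℂ)] [iGLb : BorelSpace (GL (Fin 3) ℂ)]
  [iA : MeasurableSpace (arch (↥(maximalRealSubfield L)) L (IsCMField.complexConj L) 3 (Matrix.diagonal α))]
  [iAb : BorelSpace (arch (↥(maximalRealSubfield L)) L (IsCMField.complexConj L) 3 (Matrix.diagonal α))]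

set_option maxHeartbeats 800000 in
/-- **(end-read)⁺ THE WALL-MEASURE INTEGRAL IS A UNIVERSAL POSITIVE MULTIPLE OF THE TOP-FORM CLASS ORBITAL INTEGRAL AT THE RELABELLED WALL TORUS POINT**: for the wall data of
★ `K2E4ArchGPrimeDefs` (Haar `ν_v`, rational `e₁ ≠ e₂` on the unit circle, pinned references `νH` with `hpin`) and `ν = χ • e⁻¹_*⊗ν_v`, there is a REAL `r > 0` with
`∫ Θ ↑↑(e⁻¹ o) d(⊗_v Wm_v(ρ_v)) = r · Φ(⟦t(z⁰∘ρ)⟧, Θ∘coe; archSingularTopFormFamily ν)` for EVERY continuous compactly supported `Θ` and EVERY `ρ` (`r = (χ⁻¹·K).toReal`, `K` the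
universal pin ratio of ★ (U)).  This is the `hread` hypothesis of ★ `K2E4ArchGPrimeLamPhase.exists_gState_univ_eq_of_wallIntegral_signed` verbatim (★ p855485 with `r` real positive).
[cite: Rogawski1990, §8.2 pp. 122–124; §1.7 p. 6; §4.3 (4.3.1) p. 43] [cite: DeitmarEchterhoff2014, Thm. 1.5.3] -/
theorem exists_pos_wallIntegral_eq_mul_classOrbitalIntegral
    (hα : ∀ i, α i ≠ 0) (hherm : ∀ i, (IsCMField.complexConj L (α i) : L) = α i)
    (νw : ∀ v : {w : InfinitePlace L // IsComplex w}, Measure (archLocal L 3 (Matrix.diagonal α) v)) (hνw : ∀ v, (νw v).IsHaarMeasure ∧ (νw v).IsMulRightInvariant)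
    (e₁ e₂ : L) (h₁ : (IsCMField.complexConj L e₁ : L) * e₁ = 1) (h₂ : (IsCMField.complexConj L e₂ : L) * e₂ = 1) (hne : e₁ ≠ e₂)
    [iR : ∀ (w : {w : InfinitePlace L // IsComplex w}) (τ : Perm (Fin 3)), MeasurableSpace (archLocal L 3 (Matrix.diagonal (α ∘ ⇑τ)) w ⧸ Subgroup.centralizer
      ({(⟨circleDiagonal 3 (wallPoint L e₁ e₂ h₁ h₂ w), circleDiagonal_mem_archLocal_diagonal L 3 (α ∘ ⇑τ) w (wallPoint L e₁ e₂ h₁ h₂ w)⟩ : archLocal L 3 (Matrix.diagonal (α ∘ ⇑τ)) w)} :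
        Set (archLocal L 3 (Matrix.diagonal (α ∘ ⇑τ)) w)))]
    [iRb : ∀ (w : {w : InfinitePlace L // IsComplex w}) (τ : Perm (Fin 3)), BorelSpace (archLocal L 3 (Matrix.diagonal (α ∘ ⇑τ)) w ⧸ Subgroup.centralizer
      ({(⟨circleDiagonal 3 (wallPoint L e₁ e₂ h₁ h₂ w), circleDiagonal_mem_archLocal_diagonal L 3 (α ∘ ⇑τ) w (wallPoint L e₁ e₂ h₁ h₂ w)⟩ : archLocal L 3 (Matrix.diagonal (α ∘ ⇑τ)) w)} :
        Set (archLocal L 3 (Matrix.diagonal (α ∘ ⇑τ)) w)))]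
    (νH : ∀ (w : {w : InfinitePlace L // IsComplex w}) (τ : Perm (Fin 3)), Measure (Subgroup.centralizer
      ({(⟨circleDiagonal 3 (wallPoint L e₁ e₂ h₁ h₂ w), circleDiagonal_mem_archLocal_diagonal L 3 (α ∘ ⇑τ) w (wallPoint L e₁ e₂ h₁ h₂ w)⟩ : archLocal L 3 (Matrix.diagonal (α ∘ ⇑τ)) w)} :
        Set (archLocal L 3 (Matrix.diagonal (α ∘ ⇑τ)) w))))
    (hνH : ∀ w τ, (νH w τ).IsHaarMeasure ∧ (νH w τ).IsInvInvariant)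
    (hpin : ∀ (w : {w : InfinitePlace L // IsComplex w}) (τ : Perm (Fin 3)), (w.1.embedding (α (τ 0))).re * (w.1.embedding (α (τ 2))).re < 0 →
        haveI : LocallyCompactSpace (archLocal L 3 (Matrix.diagonal (α ∘ ⇑τ)) w) := locallyCompactSpace_archLocal L 3 (Matrix.diagonal (α ∘ ⇑τ)) w
        haveI : SecondCountableTopology (archLocal L 3 (Matrix.diagonal (α ∘ ⇑τ)) w) := secondCountableTopology_archLocal L 3 (Matrix.diagonal (α ∘ ⇑τ)) w
        haveI : (νH w τ).IsHaarMeasure := (hνH w τ).1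
        haveI : (νH w τ).IsInvInvariant := (hνH w τ).2
        ∃ (ν : Measure (archLocal L 3 (Matrix.diagonal (α ∘ ⇑τ)) w)) (_ : ν.IsHaarMeasure) (_ : ν.IsMulRightInvariant),
          ∀ (Θ : Matrix (Fin 3) (Fin 3) ℂ → ℂ), ContDiff ℝ (⊤ : ℕ∞) Θ →
            HasCompactSupport (fun k : archLocal L 3 (Matrix.diagonal (α ∘ ⇑τ)) w => Θ ((k : GL (Fin 3) ℂ) : Matrix (Fin 3) (Fin 3) ℂ)) →
            ∀ (z₀ : Fin 3 → Circle) (h02' : z₀ 0 = z₀ 2) (h01' : z₀ 0 ≠ z₀ 1),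
              Tendsto (fun ψ : ℝ => deriv (fun ψ : ℝ => (2 * Real.sin ψ : ℂ) *
                  ∫ g, Θ (((g * ⟨circleDiagonal 3 (fun i => z₀ i * Circle.exp (![(1 : ℝ), 0, -1] i * ψ)),
                    circleDiagonal_mem_archLocal_diagonal L 3 (α ∘ ⇑τ) w _⟩ * g⁻¹ : archLocal L 3 (Matrix.diagonal (α ∘ ⇑τ)) w) : GL (Fin 3) ℂ) : Matrix (Fin 3) (Fin 3) ℂ) ∂(ν)) ψ)
                (𝓝[≠] 0)
                (𝓝 ((-1 : ℂ) * ∫ y, descConj (⟨circleDiagonal 3 z₀, circleDiagonal_mem_archLocal_diagonal L 3 (α ∘ ⇑τ) w z₀⟩ : archLocal L 3 (Matrix.diagonal (α ∘ ⇑τ)) w)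
                  (Subgroup.centralizer ({(⟨circleDiagonal 3 (wallPoint L e₁ e₂ h₁ h₂ w), circleDiagonal_mem_archLocal_diagonal L 3 (α ∘ ⇑τ) w (wallPoint L e₁ e₂ h₁ h₂ w)⟩ : archLocal L 3 (Matrix.diagonal (α ∘ ⇑τ)) w)} : Set (archLocal L 3 (Matrix.diagonal (α ∘ ⇑τ)) w)))
                  (forall_mem_centralizer_circleDiagonal_comm_of_wall L (α ∘ ⇑τ) w (wallPoint_zero_eq_two L e₁ e₂ h₁ h₂ w) (wallPoint_zero_ne_one L e₁ e₂ h₁ h₂ hne w) h02' h01')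
                  (fun k : archLocal L 3 (Matrix.diagonal (α ∘ ⇑τ)) w => Θ ((k : GL (Fin 3) ℂ) : Matrix (Fin 3) (Fin 3) ℂ)) y
                  ∂(quotientMeasure _ (νH w τ) (isClosed_coe_centralizer_singleton _) (ν)))))
    [iCQ : ∀ γ : arch (↥(maximalRealSubfield L)) L (IsCMField.complexConj L) 3 (Matrix.diagonal α), MeasurableSpace (arch (↥(maximalRealSubfield L)) L (IsCMField.complexConj L) 3 (Matrix.diagonal α) ⧸ Subgroup.centralizer ({γ} : Set (arch (↥(maximalRealSubfield L)) L (IsCMField.complexConj L) 3 (Matrix.diagonal α))))]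
    [iCQb : ∀ γ : arch (↥(maximalRealSubfield L)) L (IsCMField.complexConj L) 3 (Matrix.diagonal α), BorelSpace (arch (↥(maximalRealSubfield L)) L (IsCMField.complexConj L) 3 (Matrix.diagonal α) ⧸ Subgroup.centralizer ({γ} : Set (arch (↥(maximalRealSubfield L)) L (IsCMField.complexConj L) 3 (Matrix.diagonal α))))]
    (ν : Measure (arch (↥(maximalRealSubfield L)) L (IsCMField.complexConj L) 3 (Matrix.diagonal α))) [iνH : ν.IsHaarMeasure] [iνR : ν.IsMulRightInvariant]
    (χ : ℝ≥0∞) (hχ0 : χ ≠ 0) (hχ : χ ≠ ⊤) (hν : ν = χ • (Measure.pi νw).map (archPiEquivCM 3 L (Matrix.diagonal α)).symm) :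
    ∃ r : ℝ, 0 < r ∧ ∀ (Θ : Matrix (Fin 3) (Fin 3) (mixedSpace L) → ℂ), Continuous Θ →
      HasCompactSupport (fun g : arch (↥(maximalRealSubfield L)) L (IsCMField.complexConj L) 3 (Matrix.diagonal α) => Θ ((g : GL (Fin 3) (mixedSpace L)) : Matrix (Fin 3) (Fin 3) (mixedSpace L))) →
      ∀ ρ : {w : InfinitePlace L // IsComplex w} → Perm (Fin 3),
        ∫ o, Θ ((((archPiEquivCM 3 L (Matrix.diagonal α)).symm o : arch (↥(maximalRealSubfield L)) L (IsCMField.complexConj L) 3 (Matrix.diagonal α)) :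
            GL (Fin 3) (mixedSpace L)) : Matrix (Fin 3) (Fin 3) (mixedSpace L))
          ∂(Measure.pi fun v => wallMeasure L α νw hνw e₁ e₂ h₁ h₂ hne νH hνH v (ρ v)) =
        (r : ℂ) * classOrbitalIntegral (Literature.NumberTheory.Weil1964.UnitaryArchTopForm.archSingularTopFormFamily L (Matrix.diagonal α) ν)
          (fun g : arch (↥(maximalRealSubfield L)) L (IsCMField.complexConj L) 3 (Matrix.diagonal α) => Θ ((g : GL (Fin 3) (mixedSpace L)) : Matrix (Fin 3) (Fin 3) (mixedSpace L)))
          (ConjClasses.mk (archDiagTorus L 3 α fun v => wallPoint L e₁ e₂ h₁ h₂ v ∘ ⇑(ρ v))) := by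
  classical
  -- ## Prop-instances of the side-`α` local groups (the `α∘τ`-carrier instances are SCOPED to the terms that need them — two carriers' `∀ w`-instances in one
  -- context make typeclass search unify `archLocal … α w` with `archLocal … (α∘τ) w` by unfolding; ★ (D5)'s elaboration rule)
  haveI iLC : ∀ v : {w : InfinitePlace L // IsComplex w}, LocallyCompactSpace (archLocal L 3 (Matrix.diagonal α) v) := fun v => locallyCompactSpace_archLocal L 3 (Matrix.diagonal α) v
  haveI iSC : ∀ v : {w : InfinitePlace L // IsComplex w}, SecondCountableTopology (archLocal L 3 (Matrix.diagonal α) v) := fun v => secondCountableTopology_archLocal L 3 (Matrix.diagonal α) v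
  haveI iνh : ∀ v : {w : InfinitePlace L // IsComplex w}, (νw v).IsHaarMeasure := fun v => (hνw v).1
  haveI iνr : ∀ v : {w : InfinitePlace L // IsComplex w}, (νw v).IsMulRightInvariant := fun v => (hνw v).2
  -- the (V7) product Haar measure `μ₀ = e⁻¹_*(⊗ν_v)`; `ν = χ • μ₀`
  haveI iμh : ((Measure.pi νw).map (archPiEquivCM 3 L (Matrix.diagonal α)).symm).IsHaarMeasure := isHaarMeasure_map_archPiEquivCM_symm_pi L 3 α νw
  haveI iμr : ((Measure.pi νw).map (archPiEquivCM 3 L (Matrix.diagonal α)).symm).IsMulRightInvariant := by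
    have h : (Measure.pi νw).map (archPiEquivCM 3 L (Matrix.diagonal α)).symm = χ⁻¹ • ν := by
      rw [hν, smul_smul, ENNReal.inv_mul_cancel hχ0 hχ, one_smul]
    rw [h]; infer_instance
  -- ## the wall data: real diagonal entries, the wall point is in normal form and of rational type
  have hreal : ∀ (w : {w : InfinitePlace L // IsComplex w}) (i : Fin 3), (w.1.embedding (α i)).im = 0 :=
    fun w i => im_embedding_eq_zero_of_complexConj_eq L w (hherm i)
  have hwall : ∀ w : {w : InfinitePlace L // IsComplex w}, wallPoint L e₁ e₂ h₁ h₂ w 0 = wallPoint L e₁ e₂ h₁ h₂ w 2 ∧ wallPoint L e₁ e₂ h₁ h₂ w 0 ≠ wallPoint L e₁ e₂ h₁ h₂ w 1 :=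
    fun w => ⟨wallPoint_zero_eq_two L e₁ e₂ h₁ h₂ w, wallPoint_zero_ne_one L e₁ e₂ h₁ h₂ hne w⟩
  have hrat : ∃ a b : L, ∀ w : {w : InfinitePlace L // IsComplex w}, ((wallPoint L e₁ e₂ h₁ h₂ w 0 : ℂ) = w.1.embedding a) ∧ ((wallPoint L e₁ e₂ h₁ h₂ w 1 : ℂ) = w.1.embedding b) :=
    ⟨e₁, e₂, fun w => ⟨rfl, rfl⟩⟩
  -- ## the universal pin ratio (U) (U4 ★ discharged) and the pinned centraliser measures
  obtain ⟨K, hK, hU⟩ := @archSingularUniversalPinRatio_of_wallCompatible L _ _ _ (archTopFormWallCompatible_holds L) iGL iGLb α hα hherm iA iAb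
    (wallPoint L e₁ e₂ h₁ h₂) (wallPoint_zero_eq_two L e₁ e₂ h₁ h₂) (wallPoint_zero_ne_one L e₁ e₂ h₁ h₂ hne) iR iRb
  obtain ⟨ρZ, hρZi, hρZ, hρZ1⟩ := exists_pinned_centralizer_families L α hα hreal (wallPoint L e₁ e₂ h₁ h₂) (wallPoint_zero_eq_two L e₁ e₂ h₁ h₂)
    (wallPoint_zero_ne_one L e₁ e₂ h₁ h₂ hne) νH hνH (κ := Unit) (fun _ => wallPoint L e₁ e₂ h₁ h₂) (fun _ w => hwall w)
  -- ## the transported Haar measures `ντ` of ★ (P1) (instances of the `α∘τ`-carrier scoped inside)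
  have hντi : ∀ (v : {w : InfinitePlace L // IsComplex w}) (τ : Perm (Fin 3)),
      ((νw v).map (ContinuousMulEquiv.restrictSubgroup (GLn.conjEquiv (Matrix.GeneralLinearGroup.mkOfDetNeZero _ (det_monomial_one_ne_zero 3 τ)))
          (archLocal L 3 (Matrix.diagonal (α ∘ ⇑τ)) v) (archLocal L 3 (Matrix.diagonal α) v) (mem_archLocal_comp_perm_iff_conj_mem L 3 α v τ)).symm).IsHaarMeasure ∧
      ((νw v).map (ContinuousMulEquiv.restrictSubgroup (GLn.conjEquiv (Matrix.GeneralLinearGroup.mkOfDetNeZero _ (det_monomial_one_ne_zero 3 τ)))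
          (archLocal L 3 (Matrix.diagonal (α ∘ ⇑τ)) v) (archLocal L 3 (Matrix.diagonal α) v) (mem_archLocal_comp_perm_iff_conj_mem L 3 α v τ)).symm).IsMulRightInvariant :=
    fun v τ =>
      haveI : LocallyCompactSpace (archLocal L 3 (Matrix.diagonal (α ∘ ⇑τ)) v) := locallyCompactSpace_archLocal L 3 (Matrix.diagonal (α ∘ ⇑τ)) v
      haveI : SecondCountableTopology (archLocal L 3 (Matrix.diagonal (α ∘ ⇑τ)) v) := secondCountableTopology_archLocal L 3 (Matrix.diagonal (α ∘ ⇑τ)) v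
      ⟨ContinuousMulEquiv.isHaarMeasure_map (νw v) _, isMulRightInvariant_map_relabel_symm L 3 α v τ (νw v)⟩
  -- ## the constant
  refine ⟨(χ⁻¹ * (K : ℝ≥0∞)).toReal, ?_, fun Θ hΘ _hΘc ρ => ?_⟩
  · have h1 : χ⁻¹ * (K : ℝ≥0∞) ≠ 0 := mul_ne_zero (ENNReal.inv_ne_zero.mpr hχ) (ENNReal.coe_ne_zero.mpr hK)
    have h2 : χ⁻¹ * (K : ℝ≥0∞) ≠ ⊤ := ENNReal.mul_ne_top (ENNReal.inv_ne_top.mpr hχ0) ENNReal.coe_ne_top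
    exact ENNReal.toReal_pos h1 h2
  -- ## per `ρ`: the telescope `ρP, ρ′` at `t(z⁰∘ρ)` (★ (W2))
  obtain ⟨ρP, ρ', ⟨iPh, iPi⟩, hρP, ⟨i'h, i'i⟩, hρ'⟩ :=
    exists_pi_centralizer_measures L 3 α (fun w => wallPoint L e₁ e₂ h₁ h₂ w ∘ ⇑(ρ w)) (fun w => ρZ () w (ρ w)) (fun w => hρZi () w (ρ w))
  haveI := iPh; haveI := iPi; haveI := i'h; haveI := i'i
  -- the pin ratio at this point: `centralizerTopFormHaar (t(z⁰∘ρ)) = K • ρ′`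
  have hKρ := hU νH hνH hpin (wallPoint L e₁ e₂ h₁ h₂) hwall hrat ρ (ρZ ()) (hρZi ()) (hρZ ()) (hρZ1 ()) ρP hρP ρ' hρ'
  -- ## the family `m := (χ⁻¹K) • (top-form family)` is in Weil form at the framed point `t(z⁰∘ρ)`
  have hframe := exists_isSingularArchFrame_archDiagTorus_wall' L α hα hherm (wallPoint L e₁ e₂ h₁ h₂) hwall hrat ρ
  obtain ⟨iTh, iTi, hat⟩ := exists_atPoint_archSingularTopFormFamily_eq L (Matrix.diagonal α) ν (archDiagTorus L 3 α fun w => wallPoint L e₁ e₂ h₁ h₂ w ∘ ⇑(ρ w)) hframe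
  have hq : ((χ⁻¹ * (K : ℝ≥0∞)) • archSingularTopFormFamily L (Matrix.diagonal α) ν).atPoint (archDiagTorus L 3 α fun w => wallPoint L e₁ e₂ h₁ h₂ w ∘ ⇑(ρ w)) =
      quotientMeasure (Subgroup.centralizer ({archDiagTorus L 3 α fun w => wallPoint L e₁ e₂ h₁ h₂ w ∘ ⇑(ρ w)} : Set _)) ρ' (isClosed_coe_centralizer_singleton _)
        ((Measure.pi νw).map (archPiEquivCM 3 L (Matrix.diagonal α)).symm) := by
    have h1 := quotientMeasure_eq_inv_smul_of_eq_smul (Subgroup.centralizer ({archDiagTorus L 3 α fun w => wallPoint L e₁ e₂ h₁ h₂ w ∘ ⇑(ρ w)} : Set _))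
      (isClosed_coe_centralizer_singleton _) ρ' (centralizerTopFormHaar L (Matrix.diagonal α) (archDiagTorus L 3 α fun w => wallPoint L e₁ e₂ h₁ h₂ w ∘ ⇑(ρ w))) ν hK hKρ
    have h2 := quotientMeasure_smul_measure (Subgroup.centralizer ({archDiagTorus L 3 α fun w => wallPoint L e₁ e₂ h₁ h₂ w ∘ ⇑(ρ w)} : Set _))
      (isClosed_coe_centralizer_singleton _) ρ' ((Measure.pi νw).map (archPiEquivCM 3 L (Matrix.diagonal α)).symm) hχ0 hχ
    have hsc : χ⁻¹ * (K : ℝ≥0∞) * ((K : ℝ≥0∞)⁻¹ * χ) = 1 := by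
      rw [mul_assoc χ⁻¹, ← mul_assoc (K : ℝ≥0∞), ENNReal.mul_inv_cancel (ENNReal.coe_ne_zero.mpr hK) ENNReal.coe_ne_top, one_mul,
        ENNReal.inv_mul_cancel hχ0 hχ]
    simp only [OrbitalMeasureFamily.atPoint, OrbitalMeasureFamily.smul_apply, Measure.map_smul]
    rw [← OrbitalMeasureFamily.atPoint, hat, h1]
    subst hν
    rw [h2]
    ext s hs
    simp only [Measure.smul_apply, ENNReal.smul_def, smul_eq_mul, ENNReal.coe_inv hK]
    calc χ⁻¹ * (K : ℝ≥0∞) * ((K : ℝ≥0∞)⁻¹ * (χ * quotientMeasure _ ρ' (isClosed_coe_centralizer_singleton _)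
            ((Measure.pi νw).map (archPiEquivCM 3 L (Matrix.diagonal α)).symm) s))
        = (χ⁻¹ * (K : ℝ≥0∞) * ((K : ℝ≥0∞)⁻¹ * χ)) * quotientMeasure _ ρ' (isClosed_coe_centralizer_singleton _)
            ((Measure.pi νw).map (archPiEquivCM 3 L (Matrix.diagonal α)).symm) s := by ring
      _ = _ := by rw [hsc, one_mul]
  -- the member at `⟦t(z⁰∘ρ)⟧` is invariant under conjugation
  haveI iS : SMulInvariantMeasure (arch (↥(maximalRealSubfield L)) L (IsCMField.complexConj L) 3 (Matrix.diagonal α))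
      (arch (↥(maximalRealSubfield L)) L (IsCMField.complexConj L) 3 (Matrix.diagonal α) ⧸
        Subgroup.centralizer ({(Quotient.out (ConjClasses.mk (archDiagTorus L 3 α fun w => wallPoint L e₁ e₂ h₁ h₂ w ∘ ⇑(ρ w))) :
          arch (↥(maximalRealSubfield L)) L (IsCMField.complexConj L) 3 (Matrix.diagonal α))} : Set _))
      (((χ⁻¹ * (K : ℝ≥0∞)) • archSingularTopFormFamily L (Matrix.diagonal α) ν) (ConjClasses.mk (archDiagTorus L 3 α fun w => wallPoint L e₁ e₂ h₁ h₂ w ∘ ⇑(ρ w)))) := by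
    have : SMulInvariantMeasure (arch (↥(maximalRealSubfield L)) L (IsCMField.complexConj L) 3 (Matrix.diagonal α))
        (arch (↥(maximalRealSubfield L)) L (IsCMField.complexConj L) 3 (Matrix.diagonal α) ⧸
          Subgroup.centralizer ({(Quotient.out (ConjClasses.mk (archDiagTorus L 3 α fun w => wallPoint L e₁ e₂ h₁ h₂ w ∘ ⇑(ρ w))) :
            arch (↥(maximalRealSubfield L)) L (IsCMField.complexConj L) 3 (Matrix.diagonal α))} : Set _))
        (archSingularTopFormFamily L (Matrix.diagonal α) ν (ConjClasses.mk (archDiagTorus L 3 α fun w => wallPoint L e₁ e₂ h₁ h₂ w ∘ ⇑(ρ w)))) := by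
      unfold archSingularTopFormFamily
      split_ifs with h
      · haveI := isHaarMeasure_centralizerTopFormHaar h.choose_spec.choose_spec.choose_spec.choose_spec.choose_spec
        haveI := isInvInvariant_centralizerTopFormHaar h.choose_spec.choose_spec.choose_spec.choose_spec.choose_spec
        exact smulInvariantMeasure_quotientMeasure _ _ _ _
      · exact ⟨fun _ _ _ => by simp only [Measure.coe_zero, Pi.zero_apply]⟩
    rw [OrbitalMeasureFamily.smul_apply]
    infer_instance
  -- ## ★ (P1) at this `ρ` (all instances passed explicitly; the side-`α` orbit quotients by arbitrary centralisers and the `Π`-quotient get `borel`)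
  letI iQ : ∀ (v : {w : InfinitePlace L // IsComplex w}) (g : archLocal L 3 (Matrix.diagonal α) v),
      MeasurableSpace (archLocal L 3 (Matrix.diagonal α) v ⧸ Subgroup.centralizer ({g} : Set (archLocal L 3 (Matrix.diagonal α) v))) := fun v g => borel _
  have iQb : ∀ (v : {w : InfinitePlace L // IsComplex w}) (g : archLocal L 3 (Matrix.diagonal α) v),
      BorelSpace (archLocal L 3 (Matrix.diagonal α) v ⧸ Subgroup.centralizer ({g} : Set (archLocal L 3 (Matrix.diagonal α) v))) := fun v g => ⟨rfl⟩
  letI iP : MeasurableSpace ((∀ w : {w : InfinitePlace L // IsComplex w}, archLocal L 3 (Matrix.diagonal α) w) ⧸ Subgroup.pi Set.univ (fun w =>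
      Subgroup.centralizer ({(⟨circleDiagonal 3 (wallPoint L e₁ e₂ h₁ h₂ w ∘ ⇑(ρ w)), circleDiagonal_mem_archLocal_diagonal L 3 α w (wallPoint L e₁ e₂ h₁ h₂ w ∘ ⇑(ρ w))⟩ :
        archLocal L 3 (Matrix.diagonal α) w)} : Set _))) := borel _
  have iPb : BorelSpace ((∀ w : {w : InfinitePlace L // IsComplex w}, archLocal L 3 (Matrix.diagonal α) w) ⧸ Subgroup.pi Set.univ (fun w =>
      Subgroup.centralizer ({(⟨circleDiagonal 3 (wallPoint L e₁ e₂ h₁ h₂ w ∘ ⇑(ρ w)), circleDiagonal_mem_archLocal_diagonal L 3 α w (wallPoint L e₁ e₂ h₁ h₂ w ∘ ⇑(ρ w))⟩ :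
        archLocal L 3 (Matrix.diagonal α) w)} : Set _))) := ⟨rfl⟩
  have hP1 := @integral_pi_wallFactor_eq_prod_smul_classOrbitalIntegral L _ _ _ α iGL iGLb iA iAb iCQ iCQb iQ iQb hα hherm (wallPoint L e₁ e₂ h₁ h₂) hwall νw hνw
    (wallPoint L e₁ e₂ h₁ h₂) (wallPoint_zero_eq_two L e₁ e₂ h₁ h₂) (wallPoint_zero_ne_one L e₁ e₂ h₁ h₂ hne) iR iRb νH hνH _ hντi rfl (ρZ ()) (hρZi ()) (hρZ ()) Θ hΘ ρ
    iP iPb ρP iPh iPi hρP iμh iμr ((χ⁻¹ * (K : ℝ≥0∞)) • archSingularTopFormFamily L (Matrix.diagonal α) ν) iS ρ' i'h i'i hρ' hq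
  have hprod : (∏ v : {w : InfinitePlace L // IsComplex w}, (if 0 < (v.1.embedding (α ((ρ v)⁻¹ 0))).re * (v.1.embedding (α ((ρ v)⁻¹ 2))).re
      then (ρZ () v (ρ v) Set.univ).toNNReal else 1 : ℝ≥0)) = 1 :=
    Finset.prod_eq_one fun v _ => by
      split_ifs with h
      · rw [hρZ1 () v (ρ v) h, ENNReal.toNNReal_one]
      · rfl
  rw [hprod, NNReal.coe_one, one_smul, classOrbitalIntegral_smul_measure_eq_mul] at hP1
  -- the wall measures ARE ★ (P1)'s wall factors (definitional unfolding of ★ Defs' `wallMeasure` ∕ `singularWallMeasure`)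
  unfold wallMeasure singularWallMeasure
  exact hP1

end Summit.HodgeConjecture.HodgeConjecture.Cruxes.H413.K2E4ArchGPrimeEndReadPos

end
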